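import Literature.NumberTheory.Automorphic.Zelevinsky1980.RankTwoUnitShell
import HarnessLib

/-!
# `End_{GL₂}(Ind_B^{GL₂} σ') = ℂ` when the two torus characters agree on units (irregular rank-two case)

Topic `NumberTheory/Automorphic/Zelevinsky1980`; theorems only (no definition, no named fact). Let `F` be
a non-archimedean local field, `B = Q_{1,1} = standardParabolicGL F (lastBlockLabel 2) ≤ GL₂(F)`, and `σ'`
a smooth one-dimensional representation of `B` (on `ℂ`) trivial on the unipotent radical `U_c` whose two
torus characters AGREE ON UNITS: `σ'(diag(u, 1)) = σ'(diag(1, u))` for `|u| = 1`. (For the inducing datum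
`(ν₀ ⊗ χ′) δ_B^{1/2}` of `ν₀ × χ′` this says `ν₀|_{𝒪ˣ} = χ′|_{𝒪ˣ}`; it holds in the IRREGULAR case
`ν₀ = χ′` of [Zelevinsky1980, Thm. 4.2], where the two exponents `σ'(diag(1,ϖ))` and
`q_F σ'(diag(ϖ,1))` of the Jacquet module of `I = Ind_B^{GL₂} σ'` coincide and the exponent separation
of `InducedMaximalParabolicEndomorphisms.exists_intertwiningMap_eq_smul` gives nothing.)

* `eq_zero_of_mem_vanishingOn_of_equivariant_two` — **every `(B, σ')`-equivariant linear functional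
  `λ` on `I` kills the open-cell part** `I_open` (functions vanishing on `B`). A NON-SEMISIMPLICITY
  WITNESS replaces exponent separation: with `K₀ ⊋ K₁` the unit and level-one boxes of `N' ≅ F`,
  `Φ₀, Φ₁` their standard sections, `d = diag(1, ϖ)`, `d₀ = diag(ϖ, 1) = w₀ d w₀`:
  `d₀ · Φ₀ = σ'(d) Φ₁` (`smoothIndRep_cellSection_of_conj_mem`) and `w₀ · (Φ₀ - Φ₁) = κ₀ (Φ₀ - Φ₁)`,
  `κ₀ = σ'(diag(-1,1)) ≠ 0` (`RankTwoUnitShell`); so for `f = w₀ · Φ₀` the vector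
  `d · f - σ'(d) f = -σ'(d) κ₀ (Φ₀ - Φ₁)` is killed by `λ`, i.e. `λ(Φ₀) = λ(Φ₁)`, while `U_c`-invariance
  and the coset decomposition `Φ₀ = ∑_{r ∈ K₀/K₁} r · Φ₁` (`cellSection_eq_sum_smoothIndRep`, at least two
  cosets) give `λ(Φ₀) = #(K₀/K₁) λ(Φ₁)`; hence `λ(Φ₁) = 0`, and the classes of the `Φ_{K₁,w}` span the
  `U₂`-coinvariants of `I_open` (`mk_mem_span_range_mk_cellSection`);
* **`exists_intertwiningMap_eq_smul_of_apply_diag_eq`** — `End_{GL₂}(I) = ℂ`: the previous theorem for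
  `λ f = (T f)(1)` and `exists_intertwiningMap_eq_smul_of_forall_vanishingOn` (Steps 2–4 of
  `exists_intertwiningMap_eq_smul`: chart decomposition, `λ = c · ev₁`, `T = c · id`).

In print this is the statement that `(Ind_B^{GL₂} χ ⊗ χ)_U` is the NON-SPLIT extension of `χ δ^{1/2}`
by itself, so that `dim Hom_B(I, σ') = 1` (Bump 1997, Thm. 4.5.1–4.5.3; Bernstein–Zelevinsky 1977,
Thm. 5.2 / §7.1 for the pair `(B, B)`); here it is obtained by finite coset counting, without Haar
measure. With complete reducibility of unitary induction (`UnitaryInductionCompleteReducibility`) and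
`isIrreducible_of_forall_intertwiningMap_of_exists_isCompl` it yields the irreducibility of `χ × χ` for
unitary `χ` (row IV-3 (b) of the cell `hodgecm-mathlib`, case `N = 2`, `ν₀ = χ′`); that assembly is not
in this file.

## References

* I. N. Bernstein, A. V. Zelevinsky, *Induced representations of reductive `p`-adic groups I*,
  Ann. Sci. ÉNS 10 (1977), Thm. 5.2, §7.1. [BernsteinZelevinskyASENS1977]
* A. V. Zelevinsky, *Induced representations of reductive `p`-adic groups II*, Ann. Sci. ÉNS 13
  (1980), §1, Thm. 4.2. [Zelevinsky1980]
* D. Bump, *Automorphic Forms and Representations* (1997), Thm. 4.5.1–4.5.3. [Bump1997]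
-/

noncomputable section

open Matrix Literature.LinearAlgebra.Matrix.DiagonalTorus

namespace Literature.NumberTheory.Automorphic.Zelevinsky1980

open ValuativeRel Valued

section RankTwo

variable {F : Type*} [Field F] [ValuativeRel F] [TopologicalSpace F] [IsNonarchimedeanLocalField F]
  (σ' : Representation ℂ ↥(standardParabolicGL F (lastBlockLabel 2)) ℂ)

/-- A non-zero element of `Fin 2` is `1`. [folklore] -/
private theorem fin_two_eq_one_of_ne_zero' {j : Fin 2} (hj : j ≠ 0) : j = 1 := by
  fin_cases j
  · exact absurd rfl hj
  · rfl

/-- In a linearly ordered commutative group with zero, `c a ≤ c b ↔ a ≤ b` for `c ≠ 0`. [folklore] -/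
private theorem mul_le_mul_iff_left_of_ne_zero' {Γ : Type*} [LinearOrderedCommGroupWithZero Γ] {c : Γ}
    (hc : c ≠ 0) (a b : Γ) : c * a ≤ c * b ↔ a ≤ b :=
  ⟨fun h => by simpa only [inv_mul_cancel_left₀ hc] using mul_le_mul_right h c⁻¹,
    fun h => mul_le_mul_right h c⟩


/-- **The irregular rank-two case, Step 1: an equivariant functional kills the open-cell part.**
Let `σ'` be a smooth character of the Borel `P = Q_{1,1} ≤ GL₂(F)` (on `ℂ`), trivial on `U_c`, whose
two torus characters AGREE ON UNITS: `σ'(diag(u, 1)) = σ'(diag(1, u))` for `|u| = 1`. Then every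
linear functional `λ` on `I = Ind_P^{GL₂} σ'` with `λ(p · f) = σ'(p) λ(f)` vanishes on the functions
vanishing on `P` (the open-cell part `I_open`). Proof (a non-semisimplicity witness in place of
exponent separation): with `K₀ ⊋ K₁` the unit and the level-one box of `N' ≅ F`, standard sections
`Φ₀, Φ₁`, and `d = diag(1, ϖ)`, `d₀ = diag(ϖ, 1)`: `d₀ · Φ₀ = σ'(d) Φ₁`, and `Φ₀ - Φ₁` (supported on the
unit shell) is an EIGENVECTOR of `w₀`; hence for `f = w₀ · Φ₀` the vector `d · f - σ'(d) f` — killed by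
`λ` — is a non-zero multiple of `Φ₀ - Φ₁`, so `λ(Φ₀) = λ(Φ₁)`; but `λ(Φ₀) = q λ(Φ₁)` by `U_c`-invariance
(`q = [K₀ : K₁] ≥ 2`), so `λ(Φ₁) = 0`, and the classes of the `Φ_{K₁,w}` span the `U`-coinvariants of
`I_open` (`mk_mem_span_range_mk_cellSection`). [cite: BernsteinZelevinskyASENS1977, Thm. 5.2 and §7.1] -/
theorem eq_zero_of_mem_vanishingOn_of_equivariant_two (hσ' : σ'.IsSmooth)
    (hU : ∀ u : ↥(standardParabolicGL F (lastBlockLabel 2)),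
      u ∈ unipotentRadicalP F (lastBlockLabel 2) → σ' u = 1)
    (hH : ∀ u : Fˣ, valuation F (u : F) = 1 →
      σ' ⟨diagGL (Fin 2) (Function.update 1 0 u), diagGL_mem_standardParabolicGL _ _⟩ 1 =
        σ' ⟨diagGL (Fin 2) (Function.update 1 (Fin.last 1) u), diagGL_mem_standardParabolicGL _ _⟩ 1)
    (lam : Representation.SmoothInd (standardParabolicGL F (lastBlockLabel 2)) σ' →ₗ[ℂ] ℂ)
    (hlamP : ∀ (p : ↥(standardParabolicGL F (lastBlockLabel 2))) f,
      lam (Representation.smoothIndRep (standardParabolicGL F (lastBlockLabel 2)) σ' (p : GL (Fin 2) F) f) =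
        σ' p 1 * lam f)
    (f : Representation.SmoothInd (standardParabolicGL F (lastBlockLabel 2)) σ')
    (hf : f ∈ vanishingOn (standardParabolicGL F (lastBlockLabel 2)) σ'
      (cellLT (K := F) (lastBlockLabel 2) Fin.revPerm)) :
    lam f = 0 := by
  classical
  haveI : T2Space F := (GaloisRepresentations.IsNonarchimedeanLocalField.isLocalField F).toT2Space
  have hc : Monotone (lastBlockLabel 2) := monotone_lastBlockLabel 2
  -- Step 0: `λ` is invariant under `U_c ⊇ N'`
  have hUP : unipotentRadicalGL F (lastBlockLabel 2) ≤ standardParabolicGL F (lastBlockLabel 2) := unipotentRadicalGL_le F _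
  have hσU : ∀ {u : GL (Fin 2) F} (hu : u ∈ unipotentRadicalGL F (lastBlockLabel 2)),
      σ' ⟨u, hUP hu⟩ = 1 := fun {u} hu => hU ⟨u, hUP hu⟩ (by
        rw [← unipotentRadicalGL_subgroupOf, Subgroup.mem_subgroupOf]; exact hu)
  have hlamU : ∀ {u : GL (Fin 2) F} (hu : u ∈ unipotentRadicalGL F (lastBlockLabel 2))
      (x : Representation.SmoothInd (standardParabolicGL F (lastBlockLabel 2)) σ'), lam (Representation.smoothIndRep (standardParabolicGL F (lastBlockLabel 2)) σ' u x) = lam x := by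
    intro u hu x
    have := hlamP ⟨u, hUP hu⟩ x
    rw [hσU hu, Module.End.one_apply, one_mul] at this
    exact this
  -- Step 1: a uniformizer, the torus elements `d = diag(1, ϖ)`, `d₀ = diag(ϖ, 1)`
  obtain ⟨ϖ, hϖ⟩ := exists_isUniformizingElement (F := F)
  have hvϖ0 : valuation F ϖ ≠ 0 := (Valuation.ne_zero_iff _).mpr hϖ.ne_zero
  have hvϖ1 : valuation F ϖ < 1 := hϖ.valuation_lt_one
  set ϖu : Fˣ := Units.mk0 ϖ hϖ.ne_zero with hϖu
  set d : GL (Fin 2) F := diagGL (Fin 2) (Function.update 1 (Fin.last 1) ϖu) with hddef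
  set d₀ : GL (Fin 2) F := diagGL (Fin 2) (Function.update 1 0 ϖu) with hd₀def
  have hdP : d ∈ standardParabolicGL F (lastBlockLabel 2) := diagGL_mem_standardParabolicGL _ _
  have hd₀P' : d₀ ∈ standardParabolicGL F (⇑OrderDual.toDual ∘ revLabel (lastBlockLabel 2)) :=
    diagGL_mem_standardParabolicGL _ _
  have hd₀P'i : d₀⁻¹ ∈ standardParabolicGL F (⇑OrderDual.toDual ∘ revLabel (lastBlockLabel 2)) :=
    Subgroup.inv_mem _ hd₀P'
  have hconj_d₀ : permGL Fin.revPerm * d₀ * (permGL Fin.revPerm)⁻¹ = d := by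
    rw [hd₀def, hddef, permGL_mul_diagGL_mul_inv]
    congr 1
    funext i
    fin_cases i <;> simp [Function.update, Fin.last]
  have hconj_d₀P : permGL Fin.revPerm * d₀ * (permGL Fin.revPerm)⁻¹ ∈ standardParabolicGL F (lastBlockLabel 2) := hconj_d₀ ▸ hdP
  have hdw : d * permGL Fin.revPerm = permGL Fin.revPerm * d₀ := by
    rw [← hconj_d₀, inv_mul_cancel_right]
  -- Step 2: the boxes `K₁ = N' ∩ K_ϖ ≤ K₀ = d₀⁻¹ K₁ d₀` (the unit box) and `d₀ K₀ d₀⁻¹ = K₁`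
  set K₁ : Subgroup ↥(oppositeCellRadical (K := F) (lastBlockLabel 2)) := (congruenceGL 2 (valuation F ϖ)).comap (oppositeCellRadical (K := F) (lastBlockLabel 2)).subtype with hK₁def
  have hK₁o : IsOpen (K₁ : Set ↥(oppositeCellRadical (K := F) (lastBlockLabel 2))) := isOpen_comap_congruenceGL hvϖ0
  have hK₁c : IsCompact (K₁ : Set ↥(oppositeCellRadical (K := F) (lastBlockLabel 2))) := isCompact_comap_congruenceGL _
  have memK₁ : ∀ x : ↥(oppositeCellRadical (K := F) (lastBlockLabel 2)), x ∈ K₁ ↔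
      valuation F (((x : GL (Fin 2) F) : Matrix (Fin 2) (Fin 2) F) 0 1) ≤ valuation F ϖ := by
    intro x
    rw [hK₁def, Subgroup.mem_comap, Subgroup.coe_subtype,
      mem_congruenceGL_iff_of_mem_oppositeCellRadical (n := 0) hvϖ1 x.2]
    constructor
    · intro h; exact h 1 one_ne_zero
    · intro h j hj; rw [fin_two_eq_one_of_ne_zero' hj]; exact h
  set K₀ : Subgroup ↥(oppositeCellRadical (K := F) (lastBlockLabel 2)) := conjSubgroup hd₀P'i K₁ with hK₀def
  have hK₀o : IsOpen (K₀ : Set ↥(oppositeCellRadical (K := F) (lastBlockLabel 2))) := isOpen_conjSubgroup _ hK₁o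
  have hK₀c : IsCompact (K₀ : Set ↥(oppositeCellRadical (K := F) (lastBlockLabel 2))) := isCompact_conjSubgroup _ hK₁c
  have entry_conj : ∀ (u : Fin 2 → Fˣ) (x : GL (Fin 2) F),
      ((diagGL (Fin 2) u * x * (diagGL (Fin 2) u)⁻¹ : GL (Fin 2) F) : Matrix (Fin 2) (Fin 2) F) 0 1 =
        (u 0 : F) * (x : Matrix (Fin 2) (Fin 2) F) 0 1 * ((u 1)⁻¹ : Fˣ) := by
    intro u x
    have h := coe_diagGL_inv_mul_mul_apply u⁻¹ x 0 1
    rw [map_inv, inv_inv] at h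
    rw [h, Pi.inv_apply, inv_inv, Pi.inv_apply]
  have memK₀ : ∀ x : ↥(oppositeCellRadical (K := F) (lastBlockLabel 2)), x ∈ K₀ ↔
      valuation F (((x : GL (Fin 2) F) : Matrix (Fin 2) (Fin 2) F) 0 1) ≤ 1 := by
    intro x
    rw [hK₀def, mem_conjSubgroup_iff, memK₁]
    have e : ((((radicalConj hd₀P'i).symm x : ↥(oppositeCellRadical (K := F) (lastBlockLabel 2))) : GL (Fin 2) F) : Matrix (Fin 2) (Fin 2) F) 0 1 =
        ϖ * (((x : GL (Fin 2) F) : Matrix (Fin 2) (Fin 2) F) 0 1) := by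
      rw [coe_radicalConj_symm, inv_inv, hd₀def, entry_conj]
      simp [hϖu]
    rw [e, map_mul]
    have := mul_le_mul_iff_left_of_ne_zero' hvϖ0
      (valuation F (((x : GL (Fin 2) F) : Matrix (Fin 2) (Fin 2) F) 0 1)) 1
    rwa [mul_one] at this
  have hK₁K₀ : K₁ ≤ K₀ := fun x hx => by
    rw [memK₀]; rw [memK₁] at hx; exact hx.trans hvϖ1.le
  have hconjK₀ : conjSubgroup hd₀P' K₀ = K₁ := by
    ext x
    rw [mem_conjSubgroup_iff, memK₀, memK₁]
    have e : ((((radicalConj hd₀P').symm x : ↥(oppositeCellRadical (K := F) (lastBlockLabel 2))) : GL (Fin 2) F) : Matrix (Fin 2) (Fin 2) F) 0 1 =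
        ϖ⁻¹ * (((x : GL (Fin 2) F) : Matrix (Fin 2) (Fin 2) F) 0 1) := by
      rw [coe_radicalConj_symm, hd₀def]
      have h := coe_diagGL_inv_mul_mul_apply (Function.update 1 0 ϖu) (x : GL (Fin 2) F) 0 1
      rw [h]
      simp [hϖu]
    rw [e, map_mul, map_inv₀]
    have := mul_le_mul_iff_left_of_ne_zero' hvϖ0
      ((valuation F ϖ)⁻¹ * valuation F (((x : GL (Fin 2) F) : Matrix (Fin 2) (Fin 2) F) 0 1)) 1
    rw [← mul_assoc, mul_inv_cancel₀ hvϖ0, one_mul, mul_one] at this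
    exact this.symm
  -- Step 3: the transversal of `K₀ / K₁` has at least two elements
  obtain ⟨R, hR⟩ := exists_isLeftTransversal (B := K₀) (T := K₁) hK₀c hK₁o
  rw [inf_eq_right.2 hK₁K₀] at hR
  obtain ⟨e₁, he₁N, -, he₁mat⟩ := exists_transvection_mem (F := F) (n := 0) (1 : F)
  have he₁K₀ : (⟨e₁, he₁N⟩ : ↥(oppositeCellRadical (K := F) (lastBlockLabel 2))) ∈ K₀ := by
    rw [memK₀, he₁mat]
    simp [Matrix.transvection]
  have he₁K₁ : (⟨e₁, he₁N⟩ : ↥(oppositeCellRadical (K := F) (lastBlockLabel 2))) ∉ K₁ := by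
    rw [memK₁, he₁mat]
    simp [Matrix.transvection, not_le.2 hvϖ1]
  have hcard : (R.card : ℂ) ≠ 1 := by
    intro h1
    have h1' : R.card = 1 := by exact_mod_cast h1
    obtain ⟨r, hr⟩ := Finset.card_eq_one.1 h1'
    have hrR : r ∈ R := by rw [hr]; exact Finset.mem_singleton_self r
    -- `r ∈ K₁` (from `1 ∈ K₀`) and `r⁻¹ e₁ ∈ K₁`, hence `e₁ ∈ K₁`
    obtain ⟨r₁, ⟨hr₁R, hr₁⟩, -⟩ := hR.existsUnique 1 K₀.one_mem
    have hr₁r : r₁ = r := by rw [hr] at hr₁R; exact Finset.mem_singleton.1 hr₁R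
    rw [hr₁r, mul_one] at hr₁
    obtain ⟨r₂, ⟨hr₂R, hr₂⟩, -⟩ := hR.existsUnique _ he₁K₀
    have hr₂r : r₂ = r := by rw [hr] at hr₂R; exact Finset.mem_singleton.1 hr₂R
    rw [hr₂r] at hr₂
    have : (⟨e₁, he₁N⟩ : ↥(oppositeCellRadical (K := F) (lastBlockLabel 2))) = r * (r⁻¹ * ⟨e₁, he₁N⟩) := by group
    exact he₁K₁ (this ▸ K₁.mul_mem (by simpa using K₁.inv_mem hr₁) hr₂)
  -- Step 4: the standard sections `Φ₀ = Φ_{K₀,1}`, `Φ₁ = Φ_{K₁,1}`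
  set Φ₀ := cellSection σ' hc hσ' K₀ hK₀o hK₀c (1 : ℂ) with hΦ₀def
  set Φ₁ := cellSection σ' hc hσ' K₁ hK₁o hK₁c (1 : ℂ) with hΦ₁def
  -- (a) `λ(Φ₀) = #R · λ(Φ₁)` (coset decomposition and `N' ⊆ U_c`)
  have ha : lam Φ₀ = (R.card : ℂ) * lam Φ₁ := by
    rw [hΦ₀def, cellSection_eq_sum_smoothIndRep hc hσ' hK₁K₀ hK₀o hK₀c hK₁o hK₁c hR (1 : ℂ), map_sum]
    rw [Finset.sum_congr rfl fun r _ => hlamU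
      (mem_unipotentRadicalGL_of_mem_oppositeCellRadical_two r.2) _, Finset.sum_const, nsmul_eq_mul]
  -- (b) `d₀ · Φ₀ = σ'(d) • Φ₁`
  have hb : Representation.smoothIndRep (standardParabolicGL F (lastBlockLabel 2)) σ' d₀ Φ₀ = σ' ⟨d, hdP⟩ 1 • Φ₁ := by
    rw [hΦ₀def, smoothIndRep_cellSection_of_conj_mem σ' hc hσ' K₀ hK₀o hK₀c (1 : ℂ) hd₀P' hconj_d₀P,
      cellSection_congr hc hσ' hconjK₀ _ _ hK₁o hK₁c]
    have e1 : σ' ⟨permGL Fin.revPerm * d₀ * (permGL Fin.revPerm)⁻¹, hconj_d₀P⟩ (1 : ℂ) =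
        σ' ⟨d, hdP⟩ 1 • (1 : ℂ) := by
      rw [smul_eq_mul, mul_one]; congr 2; exact Subtype.ext hconj_d₀
    rw [e1]
    exact (cellSectionₗ σ' hc hσ' K₁ hK₁o hK₁c).map_smul _ _
  -- (c)/(d) the unit shell `Φ₀ - Φ₁` and its symmetry under `w₀` (`RankTwoUnitShell`)
  have hκP : diagGL (Fin 2) ![-1, 1] ∈ standardParabolicGL F (lastBlockLabel 2) := diagGL_mem_standardParabolicGL _ _
  have hd : Representation.smoothIndRep (standardParabolicGL F (lastBlockLabel 2)) σ' (permGL Fin.revPerm) (Φ₀ - Φ₁) =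
      σ' ⟨diagGL (Fin 2) ![-1, 1], hκP⟩ 1 • (Φ₀ - Φ₁) :=
    smoothIndRep_permGL_sub_cellSection_unitShell σ' hU hH hσ' hϖ hK₀o hK₀c hK₁o hK₁c memK₀ memK₁
  -- Step 5: the witness `g = d · f₀ - σ'(d) f₀`, `f₀ = w₀ · Φ₀`, is killed by `λ`
  have hκ0 : σ' ⟨diagGL (Fin 2) ![-1, 1], hκP⟩ 1 ≠ 0 := apply_one_ne_zero σ' _
  have he0 : σ' ⟨d, hdP⟩ 1 ≠ 0 := apply_one_ne_zero σ' _
  have hwit : Representation.smoothIndRep (standardParabolicGL F (lastBlockLabel 2)) σ' d (Representation.smoothIndRep (standardParabolicGL F (lastBlockLabel 2)) σ' (permGL Fin.revPerm) Φ₀) - σ' ⟨d, hdP⟩ 1 • Representation.smoothIndRep (standardParabolicGL F (lastBlockLabel 2)) σ' (permGL Fin.revPerm) Φ₀ =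
      -((σ' ⟨d, hdP⟩ 1 * σ' ⟨diagGL (Fin 2) ![-1, 1], hκP⟩ 1) • (Φ₀ - Φ₁)) := by
    rw [← Module.End.mul_apply, ← map_mul, hdw, map_mul, Module.End.mul_apply, hb, map_smul,
      ← smul_sub, ← map_sub, ← neg_sub, map_neg, hd, smul_neg, smul_smul]
  have hlam01 : lam Φ₀ = lam Φ₁ := by
    have h1 : lam (Representation.smoothIndRep (standardParabolicGL F (lastBlockLabel 2)) σ' d (Representation.smoothIndRep (standardParabolicGL F (lastBlockLabel 2)) σ' (permGL Fin.revPerm) Φ₀) - σ' ⟨d, hdP⟩ 1 • Representation.smoothIndRep (standardParabolicGL F (lastBlockLabel 2)) σ' (permGL Fin.revPerm) Φ₀) = 0 := by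
      rw [map_sub, map_smul, hlamP ⟨d, hdP⟩, smul_eq_mul, sub_self]
    rw [hwit, map_neg, map_smul, map_sub, smul_eq_mul, neg_eq_zero, mul_eq_zero] at h1
    exact sub_eq_zero.1 (h1.resolve_left (mul_ne_zero he0 hκ0))
  have hΦ₁0 : lam Φ₁ = 0 := by
    have h := ha
    rw [hlam01] at h
    have : ((R.card : ℂ) - 1) * lam Φ₁ = 0 := by rw [sub_mul, one_mul, ← h, sub_self]
    exact (mul_eq_zero.1 this).resolve_left (sub_ne_zero.2 hcard)
  -- Step 6: the classes of the `Φ_{K₁,w}` span the `U₂`-coinvariants of `I_open`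
  have hK₁θ : ∀ x ∈ K₁, whittakerCharFun (1 : AddChar F Circle) (radicalToUpper hc x) = 1 := by
    intro x _; rw [whittakerCharFun_apply, AddChar.one_apply, Circle.coe_one]
  have hinv : ∀ u : ↥(upperUnitriangular (Fin 2) F),
      (lam ∘ₗ (openCellSubrep (lastBlockLabel 2) σ' (1 : AddChar F Circle)).toSubmodule.subtype) ∘ₗ
          (openCellSubrep (lastBlockLabel 2) σ' (1 : AddChar F Circle)).toRepresentation u =
        lam ∘ₗ (openCellSubrep (lastBlockLabel 2) σ' (1 : AddChar F Circle)).toSubmodule.subtype := by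
    intro u
    ext x
    change lam (((openCellSubrep (lastBlockLabel 2) σ' (1 : AddChar F Circle)).toRepresentation u x :
      Representation.SmoothInd (standardParabolicGL F (lastBlockLabel 2)) σ')) = lam (x : Representation.SmoothInd (standardParabolicGL F (lastBlockLabel 2)) σ')
    have hx : (((openCellSubrep (lastBlockLabel 2) σ' (1 : AddChar F Circle)).toRepresentation u x :
        Representation.SmoothInd (standardParabolicGL F (lastBlockLabel 2)) σ')) =
        whittakerTwist (Representation.smoothIndRep (standardParabolicGL F (lastBlockLabel 2)) σ') (1 : AddChar F Circle) u (x : Representation.SmoothInd (standardParabolicGL F (lastBlockLabel 2)) σ') := rfl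
    rw [hx, whittakerTwist_apply, whittakerCharFun_apply, AddChar.one_apply, Circle.coe_one, inv_one,
      one_smul, hlamU (mem_unipotentRadicalGL_of_mem_upperUnitriangular_two u.2)]
  set lamJ := Representation.Coinvariants.lift
    (openCellSubrep (lastBlockLabel 2) σ' (1 : AddChar F Circle)).toRepresentation
    (lam ∘ₗ (openCellSubrep (lastBlockLabel 2) σ' (1 : AddChar F Circle)).toSubmodule.subtype) hinv
    with hlamJ_def
  have hlamJ : ∀ x, lamJ (Representation.Coinvariants.mk _ x) = lam (x : Representation.SmoothInd (standardParabolicGL F (lastBlockLabel 2)) σ') :=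
    fun x => Representation.Coinvariants.lift_mk _ _ _ _
  have hspan := mk_mem_span_range_mk_cellSection (σ' := σ') (1 : AddChar F Circle) hc hσ' K₁ hK₁o hK₁c hK₁θ f hf
  have hker : Submodule.span ℂ (Set.range fun w : ℂ => Representation.Coinvariants.mk
      (openCellSubrep (lastBlockLabel 2) σ' (1 : AddChar F Circle)).toRepresentation
        ⟨cellSection σ' hc hσ' K₁ hK₁o hK₁c w, cellSection_mem_vanishingOn σ' hc hσ' K₁ hK₁o hK₁c w⟩) ≤
      LinearMap.ker lamJ := by
    rw [Submodule.span_le]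
    rintro _ ⟨w, rfl⟩
    rw [SetLike.mem_coe, LinearMap.mem_ker, hlamJ]
    change lam (cellSection σ' hc hσ' K₁ hK₁o hK₁c w) = 0
    have e : cellSection σ' hc hσ' K₁ hK₁o hK₁c w = w • Φ₁ := by
      have h := (cellSectionₗ σ' hc hσ' K₁ hK₁o hK₁c).map_smul w (1 : ℂ)
      rw [smul_eq_mul, mul_one] at h
      simpa only [cellSectionₗ_apply] using h
    rw [e, map_smul, hΦ₁0, smul_zero]
  have := hker hspan
  rw [LinearMap.mem_ker, hlamJ] at this
  exact this

/-! ### 3. `End_{GL₂}(Ind_{Q_{1,1}}^{GL₂} σ') = ℂ` when the two torus characters agree on units -/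

/-- **`End_{GL₂}(Ind_B^{GL₂} σ') = ℂ` in the irregular case.** For a smooth one-dimensional `σ'` of the
Borel `B = Q_{1,1}` trivial on `U_c` whose two torus characters agree on units
(`σ'(diag(u,1)) = σ'(diag(1,u))` for `|u| = 1` — e.g. the inducing datum `(χ ⊗ χ) δ_B^{1/2}` of
`χ × χ`, the case NOT covered by exponent separation, `exists_intertwiningMap_eq_smul`), every
intertwining operator of `I = Ind_B^{GL₂} σ'` is a scalar: the functional `λ f = (T f)(1)` is
`(B, σ')`-equivariant, kills the open-cell part (`eq_zero_of_mem_vanishingOn_of_equivariant_two`), hence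
every function vanishing on `B`, so `λ = c · ev₁` and `T = c · id`
(`exists_intertwiningMap_eq_smul_of_forall_vanishingOn`, Steps 2–4 of `exists_intertwiningMap_eq_smul`).
[cite: BernsteinZelevinskyASENS1977, Thm. 5.2 and §7.1] -/
theorem exists_intertwiningMap_eq_smul_of_apply_diag_eq (hσ' : σ'.IsSmooth)
    (hU : ∀ u : ↥(standardParabolicGL F (lastBlockLabel 2)),
      u ∈ unipotentRadicalP F (lastBlockLabel 2) → σ' u = 1)
    (hH : ∀ u : Fˣ, valuation F (u : F) = 1 →
      σ' ⟨diagGL (Fin 2) (Function.update 1 0 u), diagGL_mem_standardParabolicGL _ _⟩ 1 =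
        σ' ⟨diagGL (Fin 2) (Function.update 1 (Fin.last 1) u), diagGL_mem_standardParabolicGL _ _⟩ 1)
    (T : (Representation.smoothIndRep (standardParabolicGL F (lastBlockLabel 2)) σ').IntertwiningMap
      (Representation.smoothIndRep (standardParabolicGL F (lastBlockLabel 2)) σ')) :
    ∃ c : ℂ, ∀ f, T f = c • f := by
  classical
  -- the functional `λ f = (T f)(1)` and its `(P, σ')`-equivariance
  set lam : Representation.SmoothInd (standardParabolicGL F (lastBlockLabel 2)) σ' →ₗ[ℂ] ℂ :=
    (LinearMap.proj (1 : GL (Fin 2) F)) ∘ₗ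
      (Representation.SmoothInd.toFunₗ (standardParabolicGL F (lastBlockLabel 2)) σ' ∘ₗ T.toLinearMap)
    with hlam_def
  have hlam : ∀ f, lam f = (T f).toFun 1 := fun f => rfl
  have hT : ∀ (g : GL (Fin 2) F) (f : Representation.SmoothInd (standardParabolicGL F (lastBlockLabel 2)) σ'),
      T (Representation.smoothIndRep (standardParabolicGL F (lastBlockLabel 2)) σ' g f) = Representation.smoothIndRep (standardParabolicGL F (lastBlockLabel 2)) σ' g (T f) := fun g f => by
    have := LinearMap.congr_fun (T.isIntertwining' g) f
    exact this
  have hlamP : ∀ (p : ↥(standardParabolicGL F (lastBlockLabel 2)))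
      (f : Representation.SmoothInd (standardParabolicGL F (lastBlockLabel 2)) σ'),
      lam (Representation.smoothIndRep (standardParabolicGL F (lastBlockLabel 2)) σ' (p : GL (Fin 2) F) f) = σ' p 1 * lam f := by
    intro p f
    rw [hlam, hlam, hT, Representation.toFun_smoothIndRep_apply, one_mul, ← mul_one (p : GL (Fin 2) F),
      Representation.SmoothInd.toFun_subgroup_mul, apply_eq_mul_apply_one]
  -- `λ` kills the open-cell part (the irregular rank-two computation); Steps 2–4 of
  -- `exists_intertwiningMap_eq_smul` are `exists_intertwiningMap_eq_smul_of_forall_vanishingOn`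
  exact exists_intertwiningMap_eq_smul_of_forall_vanishingOn σ' T fun f hf =>
    eq_zero_of_mem_vanishingOn_of_equivariant_two σ' hσ' hU hH lam hlamP f hf

end RankTwo

end Literature.NumberTheory.Automorphic.Zelevinsky1980
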